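import Summits.QuantumFields.BalabanUV.Beta.FP.LegPairingGerm

/-!
# `BalabanUV.Beta.FP.LegPairingEnvelopes` — THE TABLE LEGS OF THE TAYLOR PAIRING: SMEARED FORM, ENVELOPES BY DEGREE `2 + |ι|`, AND THE PRUNING OF THE
# SUMMABLE ENTRIES (`|ι| + |κ| ≥ 3`) INTO THE WINDOW BUDGET (road «FP», LEGS generic track, module (R) part 4; [folklore], `ℤ⁴`)

HONEST DEPENDENCY (page 1, mandatory): continuum YM on T⁴ ⇐ BetaPertH ∧ nine spine estimates (0/9 proved); BetaPertH ⇐ (D1) ∧ (D4) ∧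
CAP+tail; G-an2-4 gates asym, D1 and NE2/3/4.  HONEST FRAMING (cell contract, verbatim): «discharging `BetaPertH` makes Bałaban's UV
stability UNCONDITIONAL — a real constructive-QFT result; it is NOT the continuum limit and NOT the Clay problem.»  THIS MODULE is elementary [folklore]
analysis on `ℤ⁴` over `FP/LegPairingGerm` (and through it `LegPairingRemainder`/`Bounds`/`Table`/`LegPairing`, `StencilMoments`, asym1's `LegsShellBound`); it cites
nothing, mints no `Prop` fact, 0 sorry; its `def`s (`ord`, `momV`, `env`) are data.  The GRADED bounds on the difference words of the leg
(`|dKer ι A (x,y)| ≤ C/(‖x−y‖∞+1)^{2+|ι|}`, `|ι| = ord ι ≤ 2`, and the third differences) and the stencils' bi-localisation are HYPOTHESES (road FP rows MS-3∕4,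
`LocStencil` class data).  NOT the `Leg` structure of the table legs (rows (W)(L): GERM-K), NOT the cancellation of the power-divergent entries `|ι|+|κ| ≤ 1`
(GERM-S ∕ Ward), NOT `hrep`, NOT D1, NOT BetaPertH, NOT continuum, NOT Clay.

CONTENT.  §1 `ord ι ∈ {0,1,2}` (order of the difference word).  §2 THE SMEARED FORM (Fubini): `sLeg ι κ A V p q a c = Σ'_y Σ_f dKer ι A p y a f · momV κ V q y f c`
with `momV κ V q y f c = Σ'_z m_κ(z−q)·V y z f c` the `κ`-th moment profile of the stencil's rows — the owner's «smeared leg» `Σ_r s(r)·(∂^ι A)(b, b+w+r)` of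
`REP-DESIGN.md` row LEGS, with the profile `s` = the stencil's moment profile (`sLeg_eq_smeared`, `abs_momV_le`).  §3 ENVELOPES: a graded word bound of sup-norm
power `k` gives `|sLeg ι κ A V p q a c| ≤ env_k/(‖p−q‖∞+2)^k` (`abs_sLeg_le`, global comparison again), hence `|legF … (a,c,ι,κ) w| ≤ env_{2+|ι|}/(‖w‖∞+2)^{2+|ι|}`,
`|legG …| ≤ env_{2+|κ|}/(‖w‖∞+2)^{2+|κ|}`.  §4 PRUNING: the entries with `|ι|+|κ| ≥ 3` are `O(‖w‖∞⁻⁷)`, so by `LegsShellBound.hlegs_of_hlegs_of_septicWindow` the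
`hlegs` family of `LegPairingGerm.hlegs_family_bubbleTableA` holds for the PRUNED table (entries `|ι|+|κ| ≤ 2` only: degrees 4, 5, 6) with `U₁ + 160·D′`
(`hlegs_family_bubbleTableA_pruned`).  What the END (`hdeg = 6`) still needs from the road: the entries of degree 4 and 5 cancel (GERM-S), the degree-6 legs have
continuum germs (GERM-K).
Unit `b2b-balaban-beta-d1-formalise-leaf-02` (gen 5).
-/

noncomputable section

namespace Summit.QuantumFields.BalabanUV.Beta.FP.LegPairingEnvelopes

open Finset fwdDiff
open scoped BigOperators
open Literature.MathematicalPhysics.QuantumFieldTheory.Balaban1983to89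
open Literature.MathematicalPhysics.QuantumFieldTheory.Balaban1983to89.Beta
open B12Sec2to5 (l1 l1_nonneg)
open ExpKernelCalculus (Site MKer BiLoc comp tr bubble Zl Zl_pos summable_exp_shift' tsum_exp_shift')
open KernelWard (Bdd)
open Literature.Probability.LatticeModels (annulus)
open DyadicShell (Pt supNorm toReal)
open GradedBubbles (supNorm_neg)
open WindowIdentification (psum)
open Summit.QuantumFields.BalabanUV.Beta.D1BFx.MomentTransferPeriodic (baseKer)
open Summit.QuantumFields.BalabanUV.Beta.D1BFx.DressedTablesLeg (bubbleTableA)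
open Summit.QuantumFields.BalabanUV.Beta.FP.LatticeTaylorIndex (Idx mono dOp abs_mono_le)
open Summit.QuantumFields.BalabanUV.Beta.FP.StencilMoments (summable_of_weight_exp)
open Summit.QuantumFields.BalabanUV.Beta.FP.LegPairing (dKer sLeg bdd_dKer)
open Summit.QuantumFields.BalabanUV.Beta.FP.LegPairingBounds (supNorm_le_l1 inv_pow_le_of_box abs_comp_weight_biLoc_le)
open Summit.QuantumFields.BalabanUV.Beta.FP.LegPairingRemainder (kap kap_nonneg remConst div_supNorm_add_two_pow_le bdd_of_graded)
open Summit.QuantumFields.BalabanUV.Beta.FP.LegPairingGerm (LIdx legF legG germConst_nonneg hlegs_family_bubbleTableA)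

variable {F : Type*} [Fintype F]

/-! ## §1 The order of a difference word -/

/-- [folklore] The ORDER `|ι|` of the difference word `ι : Idx 4` (`0` for the value, `1` for `Δ_k`, `2` for `Δ_kΔ_k` and `Δ_iΔ_k`). -/
def ord : Idx 4 → ℕ
  | Sum.inl _ => 0
  | Sum.inr (Sum.inl _) => 1
  | Sum.inr (Sum.inr (Sum.inl _)) => 2
  | Sum.inr (Sum.inr (Sum.inr _)) => 2

/-- [folklore] `|ι| ≤ 2`. -/
theorem ord_le_two (ι : Idx 4) : ord ι ≤ 2 := by
  rcases ι with _ | _ | _ | _ <;> simp [ord]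

/-! ## §2 The smeared form of the table legs -/

/-- [folklore] THE `κ`-TH MOMENT PROFILE of the rows of the stencil `V` about `q`: `momV κ V q y f c := Σ'_z m_κ(z−q)·V y z f c`. -/
def momV (κ : Idx 4) (V : MKer 4 F) (q y : Pt) (f c : F) : ℝ := ∑' z, mono κ (z - q) * V y z f c

section Smeared

variable {A V : MKer 4 F} {B Cv δ : ℝ} {p q : Pt}

omit [Fintype F] in
/-- [folklore] The moment-profile series is absolutely convergent with `Σ'_z |m_κ(z−q) V y z f c| ≤ C_V·κ₂·Zl(δ/2)·e^{−δ|y−q|₁}`. -/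
theorem summable_momV_term (hV : BiLoc V q q Cv δ) (hδ : 0 < δ) (κ : Idx 4) (y : Pt) (f c : F) :
    Summable (fun z => mono κ (z - q) * V y z f c)
      ∧ ∑' z, |mono κ (z - q) * V y z f c| ≤ Cv * Real.exp (-δ * l1 (y - q)) * (kap 2 δ) * Zl 4 (δ / 2) := by
  have hCv : 0 ≤ Cv := hV.nonneg f
  refine summable_of_weight_exp (q := q) (k := 2) hδ (by positivity) (fun z => ?_)
  rw [abs_mul]
  calc |mono κ (z - q)| * |V y z f c| ≤ (l1 (z - q) + 1) ^ 2 * (Cv * Real.exp (-δ * (l1 (y - q) + l1 (z - q)))) :=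
        mul_le_mul (abs_mono_le κ (z - q)) (hV y z f c) (abs_nonneg _) (by positivity)
    _ = Cv * Real.exp (-δ * l1 (y - q)) * (l1 (z - q) + 1) ^ 2 * Real.exp (-δ * l1 (z - q)) := by
        rw [show -δ * (l1 (y - q) + l1 (z - q)) = -δ * l1 (y - q) + -δ * l1 (z - q) by ring, Real.exp_add]; ring

omit [Fintype F] in
/-- [folklore] **THE MOMENT PROFILE IS EXPONENTIALLY LOCALISED**: `|momV κ V q y f c| ≤ C_V·κ₂(δ)·Zl(δ/2)·e^{−δ|y−q|₁}`. -/
theorem abs_momV_le (hV : BiLoc V q q Cv δ) (hδ : 0 < δ) (κ : Idx 4) (y : Pt) (f c : F) :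
    |momV κ V q y f c| ≤ Cv * (kap 2 δ * Zl 4 (δ / 2)) * Real.exp (-δ * l1 (y - q)) := by
  obtain ⟨hs, hb⟩ := summable_momV_term hV hδ κ y f c
  unfold momV
  have h1 : |∑' z, mono κ (z - q) * V y z f c| ≤ ∑' z, |mono κ (z - q) * V y z f c| := by
    have := norm_tsum_le_tsum_norm hs.norm
    simpa only [Real.norm_eq_abs] using this
  refine h1.trans (hb.trans (le_of_eq ?_))
  ring

/-- **THE SMEARED FORM OF A TABLE LEG** (Fubini): `sLeg ι κ A V p q a c = Σ'_y Σ_f dKer ι A p y a f · momV κ V q y f c` — the `ι`-difference leg of `A` at the row `p`,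
smeared in its free argument against the `κ`-th moment profile of the stencil (the owner's «smeared leg»). [folklore] -/
theorem sLeg_eq_smeared (hA : Bdd A B) (hV : BiLoc V q q Cv δ) (hδ : 0 < δ) (ι κ : Idx 4) (a c : F) :
    sLeg ι κ A V p q a c = ∑' y, ∑ f, dKer ι A p y a f * momV κ V q y f c := by
  classical
  have hB4 : Bdd (dKer ι A) (4 * B) := bdd_dKer ι hA
  have hB : 0 ≤ B := (abs_nonneg _).trans (hA p p a a)
  have hCv : 0 ≤ Cv := hV.nonneg a
  -- the double family and its absolute summability
  set G : Pt → Pt → ℝ := fun z y => ∑ f, mono κ (z - q) * (dKer ι A p y a f * V y z f c) with hG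
  have hbound : ∀ z y, |G z y| ≤ ((Fintype.card F : ℝ) * (4 * B) * Cv * ((l1 (z - q) + 1) ^ 2 * Real.exp (-δ * l1 (z - q))))
      * Real.exp (-δ * l1 (y - q)) := by
    intro z y
    calc |G z y| ≤ ∑ f, |mono κ (z - q) * (dKer ι A p y a f * V y z f c)| := abs_sum_le_sum_abs _ _
      _ ≤ ∑ _f : F, (l1 (z - q) + 1) ^ 2 * ((4 * B) * (Cv * Real.exp (-δ * (l1 (y - q) + l1 (z - q))))) :=
          sum_le_sum fun f _ => by
            rw [abs_mul, abs_mul]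
            exact mul_le_mul (abs_mono_le κ (z - q)) (mul_le_mul (hB4 p y a f) (hV y z f c) (abs_nonneg _) (by positivity))
              (by positivity) (by positivity)
      _ = _ := by
          rw [sum_const, card_univ, nsmul_eq_mul,
            show -δ * (l1 (y - q) + l1 (z - q)) = -δ * l1 (y - q) + -δ * l1 (z - q) by ring, Real.exp_add]
          ring
  have hg1 : Summable fun z : Pt => (Fintype.card F : ℝ) * (4 * B) * Cv * ((l1 (z - q) + 1) ^ 2 * Real.exp (-δ * l1 (z - q))) := by
    refine (summable_of_weight_exp (q := q) (k := 2) hδ (show 0 ≤ (Fintype.card F : ℝ) * (4 * B) * Cv by positivity) (fun z => ?_)).1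
    rw [abs_of_nonneg (by positivity)]; exact le_of_eq (by ring)
  have hg2 : Summable fun y : Pt => Real.exp (-δ * l1 (y - q)) := summable_exp_shift' hδ q
  have hprod := Summable.mul_of_nonneg hg1 hg2 (fun z => by positivity) (fun y => (Real.exp_pos _).le)
  have hGs : Summable (Function.uncurry G) :=
    Summable.of_norm_bounded hprod (fun zy => by rw [Real.norm_eq_abs]; exact hbound zy.1 zy.2)
  -- step 1: `sLeg` as the iterated series `Σ'_z Σ'_y G z y`
  have e1 : sLeg ι κ A V p q a c = ∑' z, ∑' y, G z y := by
    unfold sLeg comp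
    refine tsum_congr fun z => ?_
    rw [← tsum_mul_left]
    exact tsum_congr fun y => by rw [hG, mul_sum]
  -- step 2: Fubini
  rw [e1, ← hGs.tsum_comm]
  -- step 3: the inner `z`-series is `Σ_f dKer · momV`
  refine tsum_congr fun y => ?_
  have hsf : ∀ f, Summable fun z => mono κ (z - q) * (dKer ι A p y a f * V y z f c) := fun f => by
    have := ((summable_momV_term hV hδ κ y f c).1).mul_left (dKer ι A p y a f)
    refine this.congr fun z => ?_
    ring
  rw [show (fun z => G z y) = fun z => ∑ f, mono κ (z - q) * (dKer ι A p y a f * V y z f c) from rfl,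
    Summable.tsum_finsetSum (fun f _ => hsf f)]
  refine sum_congr rfl fun f _ => ?_
  unfold momV
  rw [← tsum_mul_left]
  exact tsum_congr fun z => by ring

end Smeared

/-! ## §3 Envelopes by degree -/

/-- [folklore] The envelope constant of a table leg of sup-norm degree `k`: `env n C C_V δ k := n·(C·2^k)·C_V·(κ_k·Zl(δ/2))·(κ₂·Zl(δ/2))`. -/
def env (n : ℕ) (C Cv δ : ℝ) (k : ℕ) : ℝ := (n : ℝ) * (C * 2 ^ k) * Cv * (kap k δ * Zl 4 (δ / 2)) * (kap 2 δ * Zl 4 (δ / 2))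

/-- [folklore] `0 ≤ env`. -/
theorem env_nonneg (n : ℕ) {C Cv δ : ℝ} (hC : 0 ≤ C) (hCv : 0 ≤ Cv) (hδ : 0 < δ) (k : ℕ) : 0 ≤ env n C Cv δ k := by
  have := kap_nonneg k hδ; have := kap_nonneg 2 hδ
  have hZ : (0 : ℝ) ≤ Zl 4 (δ / 2) := (Zl_pos (show (0 : ℝ) < δ / 2 by positivity)).le
  unfold env; positivity

section Envelope

variable {A V : MKer 4 F} {C Cv δ : ℝ} {p q : Pt} {ι : Idx 4} {k : ℕ}

/-- **THE ENVELOPE OF A TABLE LEG**: a graded bound of sup-norm power `k` on the word `dKer ι A` and `V` bi-localised at `(q,q)` give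
`|sLeg ι κ A V p q a c| ≤ env_k/(‖p−q‖∞+2)^k` (global comparison at `ξ = x = p`, then `StencilMoments` twice). [folklore] -/
theorem abs_sLeg_le (hC : 0 ≤ C) (hδ : 0 < δ) (hg : ∀ (x y : Pt) (a b : F), |dKer ι A x y a b| ≤ C / ((supNorm (x - y) : ℝ) + 1) ^ k)
    (hV : BiLoc V q q Cv δ) (κ : Idx 4) (a c : F) :
    |sLeg ι κ A V p q a c| ≤ env (Fintype.card F) C Cv δ k / ((supNorm (p - q) : ℝ) + 2) ^ k := by
  have hCv : 0 ≤ Cv := hV.nonneg a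
  have hL : (0 : ℝ) < (supNorm (p - q) : ℝ) + 2 := by positivity
  have hZ : (0 : ℝ) ≤ Zl 4 (δ / 2) := (Zl_pos (show (0 : ℝ) < δ / 2 by positivity)).le
  have hkk : 0 ≤ kap k δ := kap_nonneg k hδ
  -- the row `p` of the word carries the weight `(‖y−q‖∞+1)^k` after the global comparison
  have hrow : ∀ (y : Pt) (a' f : F), |dKer ι A p y a' f| ≤ C * 2 ^ k / ((supNorm (p - q) : ℝ) + 2) ^ k * ((supNorm (y - q) : ℝ) + 1) ^ k := by
    intro y a' f
    refine (hg p y a' f).trans ?_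
    have hcmp := inv_pow_le_of_box p q p y p le_rfl k
    have h00 : (supNorm (p - p) : ℝ) = 0 := by rw [sub_self, DyadicShell.supNorm_eq_zero_iff.mpr rfl, Nat.cast_zero]
    rw [h00, zero_add] at hcmp
    rw [div_eq_mul_one_div]
    refine (mul_le_mul_of_nonneg_left hcmp hC).trans (le_of_eq ?_)
    rw [mul_pow]; ring
  have hcomp : ∀ z, |comp (dKer ι A) V p z a c| ≤ (Fintype.card F : ℝ) * (C * 2 ^ k / ((supNorm (p - q) : ℝ) + 2) ^ k) * Cv
      * (kap k δ * Zl 4 (δ / 2)) * Real.exp (-δ * l1 (z - q)) :=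
    fun z => abs_comp_weight_biLoc_le (K := dKer ι A) (x := p) (k := k) (by positivity) hδ hrow hV z a c
  -- the `κ`-moment against that row
  have hC0 : 0 ≤ (Fintype.card F : ℝ) * (C * 2 ^ k / ((supNorm (p - q) : ℝ) + 2) ^ k) * Cv * (kap k δ * Zl 4 (δ / 2)) := by positivity
  obtain ⟨hs, hb⟩ := summable_of_weight_exp (q := q) (k := 2) hδ hC0 (g := fun z => mono κ (z - q) * comp (dKer ι A) V p z a c)
    (fun z => by
      rw [abs_mul]
      calc |mono κ (z - q)| * |comp (dKer ι A) V p z a c|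
          ≤ (l1 (z - q) + 1) ^ 2 * ((Fintype.card F : ℝ) * (C * 2 ^ k / ((supNorm (p - q) : ℝ) + 2) ^ k) * Cv * (kap k δ * Zl 4 (δ / 2))
              * Real.exp (-δ * l1 (z - q))) := mul_le_mul (abs_mono_le κ (z - q)) (hcomp z) (abs_nonneg _) (by positivity)
        _ = _ := by ring)
  unfold sLeg
  have h1 : |∑' z, mono κ (z - q) * comp (dKer ι A) V p z a c| ≤ ∑' z, |mono κ (z - q) * comp (dKer ι A) V p z a c| := by
    have := norm_tsum_le_tsum_norm hs.norm
    simpa only [Real.norm_eq_abs] using this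
  refine h1.trans (hb.trans (le_of_eq ?_))
  unfold env kap
  field_simp

end Envelope

/-! ## §4 The legs of the fine bubble table: envelopes by `2 + |ι|`, and the pruning of the summable entries -/

section Pruning

variable {A : MKer 4 F} {S : Fin 4 → Pt → MKer 4 F} {C Cs δ : ℝ}

/-- [folklore] **ENVELOPE OF THE FIRST TABLE LEG**: `|legF A S μ b (a,c,ι,κ) w| ≤ env_{2+|ι|}/(‖w‖∞+2)^{2+|ι|}`. -/
theorem abs_legF_le (hC : 0 ≤ C) (hδ : 0 < δ)
    (hgr : ∀ (ι : Idx 4) (x y : Pt) (a b : F), |dKer ι A x y a b| ≤ C / ((supNorm (x - y) : ℝ) + 1) ^ (2 + ord ι))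
    (hS : ∀ (κ : Fin 4) (u : Pt), BiLoc (S κ u) u u Cs δ) (μ : Fin 4) (b : Pt) (i : LIdx F) (w : Pt) :
    |legF A S μ b i w| ≤ env (Fintype.card F) C Cs δ (2 + ord i.2.2.1) / ((supNorm w : ℝ) + 2) ^ (2 + ord i.2.2.1) := by
  have h := abs_sLeg_le (p := b) hC hδ (hgr i.2.2.1) (hS μ (b + w)) i.2.2.2 i.1 i.2.1
  rwa [show b - (b + w) = -w by abel, supNorm_neg] at h

/-- [folklore] **ENVELOPE OF THE SECOND TABLE LEG**: `|legG A S ν b (a,c,ι,κ) w| ≤ env_{2+|κ|}/(‖w‖∞+2)^{2+|κ|}`. -/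
theorem abs_legG_le (hC : 0 ≤ C) (hδ : 0 < δ)
    (hgr : ∀ (ι : Idx 4) (x y : Pt) (a b : F), |dKer ι A x y a b| ≤ C / ((supNorm (x - y) : ℝ) + 1) ^ (2 + ord ι))
    (hS : ∀ (κ : Fin 4) (u : Pt), BiLoc (S κ u) u u Cs δ) (ν : Fin 4) (b : Pt) (i : LIdx F) (w : Pt) :
    |legG A S ν b i w| ≤ env (Fintype.card F) C Cs δ (2 + ord i.2.2.2) / ((supNorm w : ℝ) + 2) ^ (2 + ord i.2.2.2) := by
  have h := abs_sLeg_le (p := b + w) hC hδ (hgr i.2.2.2) (hS ν b) i.2.2.1 i.2.1 i.1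
  rwa [show b + w - b = w by abel] at h

/-- [folklore] **A SUMMABLE ENTRY** (`|ι| + |κ| ≥ 3`) is `O(‖w‖∞⁻⁷)`: `|legF i w · legG i w| ≤ env_{2+|ι|}·env_{2+|κ|}/(‖w‖∞+2)⁷`. -/
theorem abs_legF_mul_legG_le_of_three_le (hC : 0 ≤ C) (hδ : 0 < δ)
    (hgr : ∀ (ι : Idx 4) (x y : Pt) (a b : F), |dKer ι A x y a b| ≤ C / ((supNorm (x - y) : ℝ) + 1) ^ (2 + ord ι))
    (hS : ∀ (κ : Fin 4) (u : Pt), BiLoc (S κ u) u u Cs δ) (μ ν : Fin 4) (b : Pt) (i : LIdx F) (hi : 3 ≤ ord i.2.2.1 + ord i.2.2.2) (w : Pt) :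
    |legF A S μ b i w * legG A S ν b i w|
      ≤ env (Fintype.card F) C Cs δ (2 + ord i.2.2.1) * env (Fintype.card F) C Cs δ (2 + ord i.2.2.2) / ((supNorm w : ℝ) + 2) ^ 7 := by
  have hCs : 0 ≤ Cs := (hS μ b).nonneg i.1
  have hE1 := env_nonneg (Fintype.card F) hC hCs hδ (2 + ord i.2.2.1)
  have hE2 := env_nonneg (Fintype.card F) hC hCs hδ (2 + ord i.2.2.2)
  have hx : (1 : ℝ) ≤ (supNorm w : ℝ) + 2 := by have : (0 : ℝ) ≤ (supNorm w : ℝ) := Nat.cast_nonneg _; linarith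
  rw [abs_mul]
  refine (mul_le_mul (abs_legF_le hC hδ hgr hS μ b i w) (abs_legG_le hC hδ hgr hS ν b i w) (abs_nonneg _) (by positivity)).trans ?_
  rw [div_mul_div_comm, ← pow_add]
  exact div_le_div_of_nonneg_left (by positivity) (by positivity) (pow_le_pow_right₀ hx (by omega))

/-- [folklore] THE PRUNED-AWAY PART IS SEPTIC: with `hi i := (3 ≤ |ι|+|κ|)`,
`|Σ_{i : hi} cc·(legF i w·legG i w)| ≤ (Σ_{i : hi} |cc|·env·env)/(‖w‖∞+2)⁷`. -/
theorem abs_sum_high_le (hC : 0 ≤ C) (hδ : 0 < δ)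
    (hgr : ∀ (ι : Idx 4) (x y : Pt) (a b : F), |dKer ι A x y a b| ≤ C / ((supNorm (x - y) : ℝ) + 1) ^ (2 + ord ι))
    (hS : ∀ (κ : Fin 4) (u : Pt), BiLoc (S κ u) u u Cs δ) (μ ν : Fin 4) (b : Pt) (cc : ℝ) (w : Pt) :
    |∑ i ∈ (univ : Finset (LIdx F)).filter (fun i => 3 ≤ ord i.2.2.1 + ord i.2.2.2), cc * (legF A S μ b i w * legG A S ν b i w)|
      ≤ (∑ i ∈ (univ : Finset (LIdx F)).filter (fun i => 3 ≤ ord i.2.2.1 + ord i.2.2.2),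
          |cc| * (env (Fintype.card F) C Cs δ (2 + ord i.2.2.1) * env (Fintype.card F) C Cs δ (2 + ord i.2.2.2))) / ((supNorm w : ℝ) + 2) ^ 7 := by
  rw [sum_div]
  refine (abs_sum_le_sum_abs _ _).trans (sum_le_sum fun i hi => ?_)
  rw [mem_filter] at hi
  rw [abs_mul, mul_div_assoc]
  exact mul_le_mul_of_nonneg_left (abs_legF_mul_legG_le_of_three_le hC hδ hgr hS μ ν b i hi.2 w) (abs_nonneg _)

/-- [folklore] The pruned table differs from the full one by the high part: `full − low = high` (filter split of `univ`). -/
theorem sum_univ_sub_sum_low (g : LIdx F → ℝ) :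
    ∑ i : LIdx F, g i - ∑ i ∈ (univ : Finset (LIdx F)).filter (fun i => ord i.2.2.1 + ord i.2.2.2 ≤ 2), g i
      = ∑ i ∈ (univ : Finset (LIdx F)).filter (fun i => 3 ≤ ord i.2.2.1 + ord i.2.2.2), g i := by
  rw [sub_eq_iff_eq_add', ← sum_filter_add_sum_filter_not univ (fun i : LIdx F => ord i.2.2.1 + ord i.2.2.2 ≤ 2)]
  congr 1
  exact sum_congr (filter_congr fun i _ => by omega) fun _ _ => rfl

variable [Nonempty F]

/-- **THE `hlegs` BINDER FAMILY FOR THE PRUNED FINE BUBBLE TABLE** (entries `|ι|+|κ| ≤ 2` only — degrees 4, 5, 6): in the currency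
`Φ b w = a·(w_μ·w_ν·baseKer (bubbleTableA A S μ ν) b w)`, for EVERY `Bset` and `R₀`,
`∀ b ∈ Bset, |psum (Φ b) R₀ − Σ_{w ∈ annulus 4 0 R₀} w_μ·w_ν·Σ_{i : |ι|+|κ| ≤ 2} (−½a)·(legF i w·legG i w)| ≤ 160·D + 160·D′` with the germ budget `D` of
`LegPairingGerm.hlegs_family_bubbleTableA` and the pruning budget `D′ = Σ_{i : |ι|+|κ| ≥ 3} |½a|·env_{2+|ι|}·env_{2+|κ|}` — BY NAME through
`LegsShellBound.hlegs_of_hlegs_of_septicWindow`.  Hypotheses: graded word bounds of orders `≤ 2` (`hgr`) and the third differences (`h3`) on `A`, the stencils bi-localised. [folklore] -/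
theorem hlegs_family_bubbleTableA_pruned (hC : 0 ≤ C) (hδ : 0 < δ)
    (hgr : ∀ (ι : Idx 4) (x y : Pt) (a b : F), |dKer ι A x y a b| ≤ C / ((supNorm (x - y) : ℝ) + 1) ^ (2 + ord ι))
    (h3 : ∀ (i j k : Fin 4) (x y : Pt) (a b : F),
      |Δ_[(Pi.single i 1 : Pt)] (Δ_[(Pi.single j 1 : Pt)] (Δ_[(Pi.single k 1 : Pt)] fun x' => A x' y a b)) x| ≤ C / ((supNorm (x - y) : ℝ) + 1) ^ 5)
    (hS : ∀ (κ : Fin 4) (u : Pt), BiLoc (S κ u) u u Cs δ) (a : ℝ) (μ ν : Fin 4) {Bset : Finset Pt} {Φ : Pt → Pt → ℝ}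
    (hΦ : ∀ b ∈ Bset, ∀ w, Φ b w = a * (toReal w μ * toReal w ν * baseKer (bubbleTableA A S μ ν) b w)) (R₀ : ℕ) :
    ∀ b ∈ Bset, |psum (Φ b) R₀
        - ∑ w ∈ annulus 4 0 R₀, toReal w μ * toReal w ν
            * ∑ i ∈ (univ : Finset (LIdx F)).filter (fun i => ord i.2.2.1 + ord i.2.2.2 ≤ 2),
                (-(1 / 2 : ℝ) * a) * (legF A S μ b i w * legG A S ν b i w)|
      ≤ 160 * (|a| / 2 * ((Fintype.card F : ℝ) ^ 2 * remConst (Fintype.card F) C Cs Cs δ * Zl 4 (δ / 2) ^ 2))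
        + 160 * (∑ i ∈ (univ : Finset (LIdx F)).filter (fun i => 3 ≤ ord i.2.2.1 + ord i.2.2.2),
            |(-(1 / 2 : ℝ) * a)| * (env (Fintype.card F) C Cs δ (2 + ord i.2.2.1) * env (Fintype.card F) C Cs δ (2 + ord i.2.2.2))) := by
  intro b hb
  have hCs : 0 ≤ Cs := (hS 0 0).nonneg (Classical.arbitrary F)
  -- the order-zero graded bound is the `ι = inl` case of `hgr`
  have h0 : ∀ (x y : Pt) (a' b' : F), |A x y a' b'| ≤ C / ((supNorm (x - y) : ℝ) + 1) ^ 2 := fun x y a' b' => by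
    simpa [dKer, ord] using hgr (Sum.inl ()) x y a' b'
  have hfull := hlegs_family_bubbleTableA hC hδ h0 h3 hS a μ ν hΦ R₀ b hb
  have hD' : 0 ≤ ∑ i ∈ (univ : Finset (LIdx F)).filter (fun i => 3 ≤ ord i.2.2.1 + ord i.2.2.2),
      |(-(1 / 2 : ℝ) * a)| * (env (Fintype.card F) C Cs δ (2 + ord i.2.2.1) * env (Fintype.card F) C Cs δ (2 + ord i.2.2.2)) :=
    sum_nonneg fun i _ => mul_nonneg (abs_nonneg _)
      (mul_nonneg (env_nonneg _ hC hCs hδ _) (env_nonneg _ hC hCs hδ _))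
  refine LegsShellBound.hlegs_of_hlegs_of_septicWindow hD' hfull fun r _ w hw => ?_
  rw [sum_univ_sub_sum_low]
  exact (abs_sum_high_le hC hδ hgr hS μ ν b _ w).trans (div_supNorm_add_two_pow_le hD' hw)

end Pruning

end Summit.QuantumFields.BalabanUV.Beta.FP.LegPairingEnvelopes

end
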